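import Mathlib
import Summits.KontsevichZagierPeriods.Zeta5Search.Elimination.PencilConnection
import Summits.KontsevichZagierPeriods.Zeta5Search.Elimination.HalfShiftCasoratian
import Summits.KontsevichZagierPeriods.Zeta5Search.Certificates.RecordRayForms
import HarnessLib

/-!
# ζ(5) search — the coefficient FRAME MATRIX of the very-well-poised dual series and its closed-form
# CONNECTION steps (cell `pub-zeta5`, family designer fam-tele, generation 14; `g14/KERNEL-BLUEPRINT-EN.md`)

HONEST FRAMING: systematic search; no irrationality claim unless certified.

OUR work (Summit side).  Packaging layer for the kernel route to clauses (E) "Apéry-type recursion" and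
(N) "non-vanishing (window form)" of Brown–Zudilin's Theorem 1 (arXiv:2210.03391) for the tree's record-ray
objects `RecordRay.recordQ / recordP / recordForm`:

* `frameMat b` — the 3×3 matrix with rows `D(b), D(b+e₇), D(b+2e₇)`, `D = (coeffU, coeffW, coeffV)`;
  `frameMat_det : (frameMat b).det = cas3 b`.
* the SCALED CLOSED-FORM STEPS as matrix identities over proved coordinatewise theorems:
  `raise7Mat_mul_frameMat` (the companion of `fourTerm_coeff_rel_UWV`),
  `raiseMat_mul_frameMat` (`CFW3.coeff_contiguity` in slots 1..6 + the four-term relation),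
  `dsMat_mul_frameMat` (`dictionary_dsShift7` + the four-term relation),
  `hMat_mul_frameMat` (the half-shift raise `H₄₅₇`: `dictRaise_at` ×3 + the four-term relation ×2, diagonal row scaling `hScale`);
* the record sequences as ADJUGATE ENTRIES of the frame: `recordQ_eq_adjugate`, `recordP_eq_adjugate`;
* the WINDOW LEMMA of linear algebra (`vecMul_ne_zero_of_det_ne_zero`, `window_of_transport`): a nonzero row
  vector transported by `u ↦ c² · u · adj(P)` cannot have three consecutive vanishing `e₂`-coordinates at an
  index where the window determinant `det [e₂ | adj(P n) e₂ | adj(P n) adj(P (n+1)) e₂]` is nonzero.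

The 66-step chain along the ray (45 lowerings, one half-shift `H₄₅₇`, 20 diagonal shifts; all 4414 side
conditions affine in `n` and valid for every `n ≥ 1`), the polynomiality of the window determinant and the
certificate `D(1) ≡ 76 (mod 97)` are documented (and verified in exact arithmetic by three independent
implementations) in `g14/conn/`; they are NOT claimed here.  Nothing in this file is about sizes, denominators
or irrationality.
-/

noncomputable section

open Finset Matrix

namespace Summit.KontsevichZagierPeriods.Zeta5Search.RecordRay.Connection

open Summit.KontsevichZagierPeriods.Zeta5Search.DualSeries (InBox)
open Summit.KontsevichZagierPeriods.Zeta5Search.WedgeDictionary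
open Summit.KontsevichZagierPeriods.Zeta5Search.Elimination
open Summit.KontsevichZagierPeriods.Zeta5Search.DualSeriesLemma19 (bRecord)
open Literature.NumberTheory.Irrationality.BrownZudilin2022 (bOfA QOf vwpDual)
open Literature.NumberTheory.Transcendental (zetaValue)

/-! ### 1. The frame matrix -/
/-- The coefficient frame: rows `b, b+e₇, b+2e₇`, columns `U, W, V`. -/
def frameMat (b : ℕ → ℤ) : Matrix (Fin 3) (Fin 3) ℚ :=
  !![coeffU b, coeffW b, coeffV b;
     coeffU (bump b 6), coeffW (bump b 6), coeffV (bump b 6);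
     coeffU (bump (bump b 6) 6), coeffW (bump (bump b 6) 6), coeffV (bump (bump b 6) 6)]
/-- `det (frameMat b) = cas3 b` (the tree's slot-7 Casoratian is the row-0 cofactor expansion). -/
theorem frameMat_det (b : ℕ → ℤ) : (frameMat b).det = cas3 b := by
  rw [Matrix.det_fin_three]
  simp [frameMat]
  unfold cas3
  ring

/-! ### 2. The scaled closed-form steps -/
/-- The slot-exchange coefficient `κ_i(b) = b_{i+1}(b₀ − b_{i+1}) − b₇(b₀ − b₇)` of `CFW3.coeff_contiguity`
(tree slot index `i ∈ range 6`, lattice slot `i+1`). -/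
def kap (b : ℕ → ℤ) (i : ℕ) : ℚ := (b (i + 1) : ℚ) * ((b 0 : ℚ) - b (i + 1)) - (b 7 : ℚ) * ((b 0 : ℚ) - b 7)
/-- RAISE₇ (scaled by `γ₃`): the companion matrix of the four-term relation. -/
def raise7Mat (b : ℕ → ℤ) : Matrix (Fin 3) (Fin 3) ℚ :=
  !![0, topGamma3 b, 0;
     0, 0, topGamma3 b;
     -topGamma0 b, -topGamma1 b, -topGamma2 b]
/-- RAISE_{i+1} (scaled by `γ₃`), `i ∈ range 6`. -/
def raiseMat (b : ℕ → ℤ) (i : ℕ) : Matrix (Fin 3) (Fin 3) ℚ :=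
  !![topGamma3 b * kap b i, topGamma3 b, 0;
     0, topGamma3 b * kap (bump b 6) i, topGamma3 b;
     -topGamma0 b, -topGamma1 b, topGamma3 b * kap (bump (bump b 6) 6) i - topGamma2 b]
/-- DS (scaled by `γ₃`): the diagonal shift `b ↦ b⁺ = (b₀+2; b_j+1)`. -/
def dsMat (b : ℕ → ℤ) : Matrix (Fin 3) (Fin 3) ℚ :=
  !![-(topGamma3 b * dsLam b 6), topGamma3 b, 0;
     0, -(topGamma3 b * dsLam (bump b 6) 6), topGamma3 b;
     -topGamma0 b, -topGamma1 b, -(topGamma3 b * dsLam (bump (bump b 6) 6) 6) - topGamma2 b]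

/-- **RAISE₇.** `raise7Mat b · T(b) = γ₃ · T(b + e₇)`. -/
theorem raise7Mat_mul_frameMat (b : ℕ → ℤ) (hb : InBox b) (hd : 2 ≤ dOf b) (h7 : b 7 + 2 ≤ b 0) :
    raise7Mat b * frameMat b = topGamma3 b • frameMat (bump b 6) := by
  obtain ⟨hU, hW, hV⟩ := fourTerm_coeff_rel_UWV b hb hd h7
  ext i j
  fin_cases i <;> fin_cases j <;>
    simp [raise7Mat, frameMat, Matrix.mul_apply, Fin.sum_univ_three]
  · linear_combination -hU
  · linear_combination -hW
  · linear_combination -hV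

/-- **DS.** `dsMat b · T(b) = γ₃ · T(b⁺)`. -/
theorem dsMat_mul_frameMat (b : ℕ → ℤ) (hb : InBox b) (hd : 2 ≤ dOf b) (h7 : b 7 + 2 ≤ b 0) :
    dsMat b * frameMat b = topGamma3 b • frameMat (dsShift b) := by
  obtain ⟨hU, hW, hV⟩ := fourTerm_coeff_rel_UWV b hb hd h7
  have h67 : (6 : ℕ) ∈ range 7 := mem_range.2 (by norm_num)
  -- the three base points of (DS)
  have hb1 : InBox (bump b 6) := inBox_bump6 b hb (by omega)
  have hb17 : bump b 6 7 = b 7 + 1 := bump_self b 6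
  have hb10 : bump b 6 0 = b 0 := bump_zero b 6
  have hd1 : dOf (bump b 6) = dOf b - 1 := dOf_bump b h67
  have hb2 : InBox (bump (bump b 6) 6) := inBox_bump6 _ hb1 (by omega)
  have hb27 : bump (bump b 6) 6 7 = b 7 + 2 := by rw [bump_self, hb17]; ring
  have hb20 : bump (bump b 6) 6 0 = b 0 := by rw [bump_zero, hb10]
  have hd2 : dOf (bump (bump b 6) 6) = dOf b - 2 := by rw [dOf_bump _ h67, hd1]; ring
  obtain ⟨dU0, dW0, dV0⟩ := dictionary_dsShift7 b hb (by omega) (by omega)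
  obtain ⟨dU1, dW1, dV1⟩ := dictionary_dsShift7 (bump b 6) hb1 (by omega) (by omega)
  obtain ⟨dU2, dW2, dV2⟩ := dictionary_dsShift7 (bump (bump b 6) 6) hb2 (by omega) (by omega)
  rw [← bump_dsShift] at dU1 dW1 dV1
  rw [← bump_dsShift, ← bump_dsShift] at dU2 dW2 dV2
  ext i j
  fin_cases i <;> fin_cases j <;>
    simp [dsMat, frameMat, Matrix.mul_apply, Fin.sum_univ_three]
  · linear_combination (-topGamma3 b) * dU0
  · linear_combination (-topGamma3 b) * dW0
  · linear_combination (-topGamma3 b) * dV0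
  · linear_combination (-topGamma3 b) * dU1
  · linear_combination (-topGamma3 b) * dW1
  · linear_combination (-topGamma3 b) * dV1
  · linear_combination (-topGamma3 b) * dU2 - hU
  · linear_combination (-topGamma3 b) * dW2 - hW
  · linear_combination (-topGamma3 b) * dV2 - hV

/-- **RAISE_{i+1}, `i ∈ range 6`.** `raiseMat b i · T(b) = γ₃ · T(b + e_{i+1})`. -/
theorem raiseMat_mul_frameMat (b : ℕ → ℤ) (hb : InBox b) (hd : 2 ≤ dOf b) {i : ℕ} (hi : i ∈ range 6)
    (hbi : b (i + 1) ≤ b 0) (h7 : b 7 + 2 ≤ b 0) (hN : 1 ≤ (b 0).toNat) :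
    raiseMat b i * frameMat b = topGamma3 b • frameMat (bump b i) := by
  obtain ⟨hU, hW, hV⟩ := fourTerm_coeff_rel_UWV b hb hd h7
  have hi6 := mem_range.1 hi
  have h67 : (6 : ℕ) ∈ range 7 := mem_range.2 (by norm_num)
  have hne : i ≠ 6 := by omega
  have hb1 : InBox (bump b 6) := inBox_bump6 b hb (by omega)
  have hb17 : bump b 6 7 = b 7 + 1 := bump_self b 6
  have hb10 : bump b 6 0 = b 0 := bump_zero b 6
  have hb1i : bump b 6 (i + 1) = b (i + 1) := bump_of_ne b (by omega)
  have hd1 : dOf (bump b 6) = dOf b - 1 := dOf_bump b h67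
  have hb2 : InBox (bump (bump b 6) 6) := inBox_bump6 _ hb1 (by omega)
  have hb27 : bump (bump b 6) 6 7 = b 7 + 2 := by rw [bump_self, hb17]; ring
  have hb20 : bump (bump b 6) 6 0 = b 0 := by rw [bump_zero, hb10]
  have hb2i : bump (bump b 6) 6 (i + 1) = b (i + 1) := by rw [bump_of_ne _ (by omega), hb1i]
  have hd2 : dOf (bump (bump b 6) 6) = dOf b - 2 := by rw [dOf_bump _ h67, hd1]; ring
  obtain ⟨cU0, cW0, cV0⟩ := CFW3.coeff_contiguity b hb (by omega) hi hbi (by omega) hN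
  obtain ⟨cU1, cW1, cV1⟩ :=
    CFW3.coeff_contiguity (bump b 6) hb1 (by omega) hi (by omega) (by omega) (by rw [hb10]; exact hN)
  obtain ⟨cU2, cW2, cV2⟩ :=
    CFW3.coeff_contiguity (bump (bump b 6) 6) hb2 (by omega) hi (by omega) (by omega) (by rw [hb20]; exact hN)
  rw [CFW3.bump_bump_comm b hne.symm] at cU1 cW1 cV1
  rw [CFW3.bump_bump_comm (bump b 6) hne.symm, CFW3.bump_bump_comm b hne.symm] at cU2 cW2 cV2
  simp only [hb10, hb17, hb1i, hb20, hb27, hb2i] at cU1 cW1 cV1 cU2 cW2 cV2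
  push_cast at cU0 cW0 cV0 cU1 cW1 cV1 cU2 cW2 cV2
  ext r c
  fin_cases r <;> fin_cases c <;>
    simp [raiseMat, frameMat, kap, Matrix.mul_apply, Fin.sum_univ_three, hb10, hb17, hb1i, hb20, hb27, hb2i]
  · linear_combination (-topGamma3 b) * cU0
  · linear_combination (-topGamma3 b) * cW0
  · linear_combination (-topGamma3 b) * cV0
  · linear_combination (-topGamma3 b) * cU1
  · linear_combination (-topGamma3 b) * cW1
  · linear_combination (-topGamma3 b) * cV1
  · linear_combination (-topGamma3 b) * cU2 - hU
  · linear_combination (-topGamma3 b) * cW2 - hW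
  · linear_combination (-topGamma3 b) * cV2 - hV

/-- H = H₄₅₇ (half-shift raise, rows scaled by `pr`, `γ₃·pr′`, `γ₃γ₃′·pr″`): row `k` is `dictRaise_at` at `z + k·e₇`
with `D(z+3e₇)`, `D(z+4e₇)` eliminated by the four-term relation at `z` and at `z + e₇`. -/
def hMat (z : ℕ → ℤ) : Matrix (Fin 3) (Fin 3) ℚ :=
  !![raiseTh1 z, raiseTh2 z, raiseTh3 z;
     -(raiseTh3 (bump z 6) * topGamma0 z),
       topGamma3 z * raiseTh1 (bump z 6) - raiseTh3 (bump z 6) * topGamma1 z,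
       topGamma3 z * raiseTh2 (bump z 6) - raiseTh3 (bump z 6) * topGamma2 z;
     (raiseTh3 (bump (bump z 6) 6) * topGamma2 (bump z 6)
         - topGamma3 (bump z 6) * raiseTh2 (bump (bump z 6) 6)) * topGamma0 z,
       (raiseTh3 (bump (bump z 6) 6) * topGamma2 (bump z 6)
         - topGamma3 (bump z 6) * raiseTh2 (bump (bump z 6) 6)) * topGamma1 z
         - topGamma3 z * raiseTh3 (bump (bump z 6) 6) * topGamma0 (bump z 6),
       topGamma3 z * topGamma3 (bump z 6) * raiseTh1 (bump (bump z 6) 6)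
         + (raiseTh3 (bump (bump z 6) 6) * topGamma2 (bump z 6)
             - topGamma3 (bump z 6) * raiseTh2 (bump (bump z 6) 6)) * topGamma2 z
         - topGamma3 z * raiseTh3 (bump (bump z 6) 6) * topGamma1 (bump z 6)]

/-- The diagonal row scaling of the H step. -/
def hScale (z : ℕ → ℤ) : Matrix (Fin 3) (Fin 3) ℚ :=
  !![raisePr z, 0, 0;
     0, topGamma3 z * raisePr (bump z 6), 0;
     0, 0, topGamma3 z * topGamma3 (bump z 6) * raisePr (bump (bump z 6) 6)]

/-- **H (half-shift raise `z ↦ Hz = (z₀+1; z + 1_{4,5,7})`).** `hMat z · T(z) = hScale z · T(Hz)`. -/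
theorem hMat_mul_frameMat (z : ℕ → ℤ) (hz : InBox z) (hd : 3 ≤ dOf z) (h7 : z 7 + 3 ≤ z 0) :
    hMat z * frameMat z = hScale z * frameMat (hShift z) := by
  have h67 : (6 : ℕ) ∈ range 7 := mem_range.2 (by norm_num)
  have hz1 : InBox (bump z 6) := inBox_bump6 z hz (by omega)
  have hz17 : bump z 6 7 = z 7 + 1 := bump_self z 6
  have hz10 : bump z 6 0 = z 0 := bump_zero z 6
  have hd1 : dOf (bump z 6) = dOf z - 1 := dOf_bump z h67
  have hz2 : InBox (bump (bump z 6) 6) := inBox_bump6 _ hz1 (by omega)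
  have hz27 : bump (bump z 6) 6 7 = z 7 + 2 := by rw [bump_self, hz17]; ring
  have hz20 : bump (bump z 6) 6 0 = z 0 := by rw [bump_zero, hz10]
  have hd2 : dOf (bump (bump z 6) 6) = dOf z - 2 := by rw [dOf_bump _ h67, hd1]; ring
  obtain ⟨hU, hW, hV⟩ := fourTerm_coeff_rel_UWV z hz (by omega) (by omega)
  obtain ⟨hU', hW', hV'⟩ := fourTerm_coeff_rel_UWV (bump z 6) hz1 (by omega) (by omega)
  obtain ⟨⟨rU0, rW0⟩, rV0⟩ := dictRaise_at z hz (by omega) (by omega)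
  obtain ⟨⟨rU1, rW1⟩, rV1⟩ := dictRaise_at (bump z 6) hz1 (by omega) (by omega)
  obtain ⟨⟨rU2, rW2⟩, rV2⟩ := dictRaise_at (bump (bump z 6) 6) hz2 (by omega) (by omega)
  rw [hShift_bump6] at rU1 rW1 rV1
  rw [hShift_bump6, hShift_bump6] at rU2 rW2 rV2
  ext i j
  fin_cases i <;> fin_cases j <;>
    simp [hMat, hScale, frameMat, Matrix.mul_apply, Fin.sum_univ_three]
  · linear_combination rU0
  · linear_combination rW0
  · linear_combination rV0
  · linear_combination topGamma3 z * rU1 - raiseTh3 (bump z 6) * hU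
  · linear_combination topGamma3 z * rW1 - raiseTh3 (bump z 6) * hW
  · linear_combination topGamma3 z * rV1 - raiseTh3 (bump z 6) * hV
  · linear_combination (topGamma3 z * topGamma3 (bump z 6)) * rU2
      + (raiseTh3 (bump (bump z 6) 6) * topGamma2 (bump z 6)
          - topGamma3 (bump z 6) * raiseTh2 (bump (bump z 6) 6)) * hU
      - (topGamma3 z * raiseTh3 (bump (bump z 6) 6)) * hU'
  · linear_combination (topGamma3 z * topGamma3 (bump z 6)) * rW2
      + (raiseTh3 (bump (bump z 6) 6) * topGamma2 (bump z 6)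
          - topGamma3 (bump z 6) * raiseTh2 (bump (bump z 6) 6)) * hW
      - (topGamma3 z * raiseTh3 (bump (bump z 6) 6)) * hW'
  · linear_combination (topGamma3 z * topGamma3 (bump z 6)) * rV2
      + (raiseTh3 (bump (bump z 6) 6) * topGamma2 (bump z 6)
          - topGamma3 (bump z 6) * raiseTh2 (bump (bump z 6) 6)) * hV
      - (topGamma3 z * raiseTh3 (bump (bump z 6) 6)) * hV'

/-! ### 3. The record sequences as adjugate entries of the frame -/

/-- `b′ = b + e₇` on the record ray, as a `bump`. -/
theorem bRecord'_eq_bump (n : ℕ) : bRecord' n = bump (bRecord n) 6 := rfl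

/-- `recordQ n = ρ_n · adj(T(b_n))₂₂` (the `U ∧ W` minor on the rows `b_n, b_n + e₇`). -/
theorem recordQ_eq_adjugate {n : ℕ} (hn : 1 ≤ n) :
    (recordQ n : ℚ) = rhoOf (aRec n) * (frameMat (bRecord n)).adjugate 2 2 := by
  have h : (frameMat (bRecord n)).adjugate 2 2 =
      coeffU (bRecord n) * coeffW (bRecord' n) - coeffU (bRecord' n) * coeffW (bRecord n) := by
    rw [Matrix.adjugate_fin_three, bRecord'_eq_bump]
    simp [frameMat]
    ring
  rw [h]
  exact recordQ_eq_wedge hn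

/-- `recordP n = −ρ_n · adj(T(b_n))₀₂` (the `W ∧ V` minor on the rows `b_n, b_n + e₇`). -/
theorem recordP_eq_adjugate (n : ℕ) :
    recordP n = -(rhoOf (aRec n) * (frameMat (bRecord n)).adjugate 0 2) := by
  rw [recordP, Matrix.adjugate_fin_three]
  simp [frameMat, bRecord'_eq_bump]
  ring

/-! ### 4. The real frame and `recordForm` -/

/-- The real frame: rows `b, b+e₇, b+2e₇`, columns `U, W, F̃₇` (`F̃₇ = vwpDual 7`). -/
def realFrame (b : ℕ → ℤ) : Matrix (Fin 3) (Fin 3) ℝ :=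
  !![(coeffU b : ℝ), (coeffW b : ℝ), vwpDual 7 b;
     (coeffU (bump b 6) : ℝ), (coeffW (bump b 6) : ℝ), vwpDual 7 (bump b 6);
     (coeffU (bump (bump b 6) 6) : ℝ), (coeffW (bump (bump b 6) 6) : ℝ), vwpDual 7 (bump (bump b 6) 6)]

/-- The period matrix `G`: `(U, W, F̃₇) = (U, W, V) · G` on the convergent box (`vwp_decomposition`). -/
def gMat : Matrix (Fin 3) (Fin 3) ℝ := !![1, 0, zetaValue 5; 0, 1, zetaValue 3; 0, 0, -1]

/-- `det G = −1`. -/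
theorem gMat_det : gMat.det = -1 := by
  rw [Matrix.det_fin_three]
  simp [gMat]

/-- `recordForm n = −ρ_n · adj(T_ℝ(b_n))₀₂` — definitional, no convergence needed. -/
theorem recordForm_eq_adjugate (n : ℕ) :
    recordForm n = -((rhoOf (aRec n) : ℝ) * (realFrame (bRecord n)).adjugate 0 2) := by
  rw [recordForm, Matrix.adjugate_fin_three, bRecord'_eq_bump]
  simp [realFrame]
  ring

/-- On the box with `d(b) ≥ 1`, `b₇ + 2 ≤ b₀` the real frame factors through the rational one:
`T_ℝ(b) = T(b) · G` (three instances of `vwp_decomposition`). -/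
theorem realFrame_eq (b : ℕ → ℤ) (hb : InBox b) (hd : 1 ≤ dOf b) (h7 : b 7 + 2 ≤ b 0) :
    realFrame b = (frameMat b).map ((↑) : ℚ → ℝ) * gMat := by
  have h67 : (6 : ℕ) ∈ range 7 := mem_range.2 (by norm_num)
  have hb1 : InBox (bump b 6) := inBox_bump6 b hb (by omega)
  have hb17 : bump b 6 7 = b 7 + 1 := bump_self b 6
  have hb10 : bump b 6 0 = b 0 := bump_zero b 6
  have hd1 : dOf (bump b 6) = dOf b - 1 := dOf_bump b h67
  have hb2 : InBox (bump (bump b 6) 6) := inBox_bump6 _ hb1 (by omega)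
  have hb20 : bump (bump b 6) 6 0 = b 0 := by rw [bump_zero, hb10]
  have hd2 : dOf (bump (bump b 6) 6) = dOf b - 2 := by rw [dOf_bump _ h67, hd1]; ring
  have hs0 : ∑ j ∈ range 7, b (j + 1) ≤ 3 * b 0 + 1 := by
    have h0 := hd; simp only [dOf] at h0; omega
  have hs1 : ∑ j ∈ range 7, (bump b 6) (j + 1) ≤ 3 * (bump b 6) 0 + 1 := by
    have h0 := hd; have h1 := hd1; simp only [dOf] at h0 h1; omega
  have hs2 : ∑ j ∈ range 7, (bump (bump b 6) 6) (j + 1) ≤ 3 * (bump (bump b 6) 6) 0 + 1 := by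
    have h0 := hd; have h2 := hd2; simp only [dOf] at h0 h2; omega
  have e0 := (vwp_decomposition b hb hs0).2
  have e1 := (vwp_decomposition _ hb1 hs1).2
  have e2 := (vwp_decomposition _ hb2 hs2).2
  ext i j
  fin_cases i <;> fin_cases j <;>
    simp [realFrame, frameMat, gMat, Matrix.mul_apply, Fin.sum_univ_three, e0, e1, e2] <;> ring

/-- Hence `det T_ℝ(b) = −cas3(b)` there (nonzero on the interior by `cas3_ne_zero`). -/
theorem realFrame_det (b : ℕ → ℤ) (hb : InBox b) (hd : 1 ≤ dOf b) (h7 : b 7 + 2 ≤ b 0) :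
    (realFrame b).det = -((cas3 b : ℚ) : ℝ) := by
  rw [realFrame_eq b hb hd h7, Matrix.det_mul, gMat_det, ← frameMat_det]
  have hmap : (frameMat b).map ((↑) : ℚ → ℝ) = (Rat.castHom ℝ).mapMatrix (frameMat b) := rfl
  rw [hmap, ← RingHom.map_det, Rat.coe_castHom]
  ring

/-! ### 5. The window lemma (pure linear algebra) and the reduction of clause (N) -/

/-- A nonzero row vector times a matrix with nonzero determinant is nonzero. -/
theorem vecMul_ne_zero_of_det_ne_zero {R : Type*} [Field R] {u : Fin 3 → R} (hu : u ≠ 0)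
    {W : Matrix (Fin 3) (Fin 3) R} (hW : W.det ≠ 0) : Matrix.vecMul u W ≠ 0 := by
  intro h
  apply hu
  have hWu : IsUnit W.det := isUnit_iff_ne_zero.2 hW
  have := congrArg (fun v => Matrix.vecMul v W⁻¹) h
  simpa [Matrix.vecMul_vecMul, Matrix.mul_nonsing_inv _ hWu] using this

/-- The WINDOW MATRIX of two consecutive step matrices: columns `e₂`, `adj(P₀) e₂`, `adj(P₀) adj(P₁) e₂`. -/
def windowMat {R : Type*} [CommRing R] (P0 P1 : Matrix (Fin 3) (Fin 3) R) : Matrix (Fin 3) (Fin 3) R :=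
  Matrix.of fun i j =>
    if j = 0 then (if i = 2 then 1 else 0)
    else if j = 1 then P0.adjugate i 2
    else (P0.adjugate * P1.adjugate) i 2

/-- **Window lemma.** If `u₁ = c₀ • u₀ ᵥ* adj(P₀)`, `u₂ = c₁ • u₁ ᵥ* adj(P₁)` with `c₀ c₁ ≠ 0`, `u₀ ≠ 0`, and the
window determinant is nonzero, then the `e₂`-coordinates `u₀ 2, u₁ 2, u₂ 2` are not all zero. -/
theorem window_of_transport {R : Type*} [Field R] {P0 P1 : Matrix (Fin 3) (Fin 3) R} {c0 c1 : R}
    (hc0 : c0 ≠ 0) (hc1 : c1 ≠ 0) {u0 u1 u2 : Fin 3 → R}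
    (h1 : u1 = c0 • Matrix.vecMul u0 P0.adjugate) (h2 : u2 = c1 • Matrix.vecMul u1 P1.adjugate)
    (hu : u0 ≠ 0) (hD : (windowMat P0 P1).det ≠ 0) :
    u0 2 ≠ 0 ∨ u1 2 ≠ 0 ∨ u2 2 ≠ 0 := by
  by_contra hcon
  push Not at hcon
  obtain ⟨e0, e1, e2⟩ := hcon
  have k1 : Matrix.vecMul u0 P0.adjugate 2 = 0 := by
    have h := e1
    rw [h1, Pi.smul_apply, smul_eq_mul] at h
    exact (mul_eq_zero.1 h).resolve_left hc0
  have k2 : Matrix.vecMul u0 (P0.adjugate * P1.adjugate) 2 = 0 := by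
    have h := e2
    rw [h2, h1, Matrix.smul_vecMul, Matrix.vecMul_vecMul, Pi.smul_apply, Pi.smul_apply, smul_eq_mul,
      smul_eq_mul] at h
    exact (mul_eq_zero.1 ((mul_eq_zero.1 h).resolve_left hc1)).resolve_left hc0
  simp only [Matrix.vecMul, dotProduct, Fin.sum_univ_three] at k1 k2
  apply vecMul_ne_zero_of_det_ne_zero hu hD
  ext j
  fin_cases j
  · simp [windowMat, Matrix.vecMul, dotProduct, e0]
  · simp [windowMat, Matrix.vecMul, dotProduct, Fin.sum_univ_three]
    linear_combination k1
  · simp [windowMat, Matrix.vecMul, dotProduct, Fin.sum_univ_three]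
    linear_combination k2

/-- Row transport of the adjugate under a scaled step `T₁ = c • (P · T₀)` (3×3):
`adj(T₁) i = c² • adj(T₀) i ᵥ* adj(P)`. -/
theorem adjugate_row_of_step {R : Type*} [CommRing R] {T0 T1 P : Matrix (Fin 3) (Fin 3) R} {c : R}
    (h : T1 = c • (P * T0)) (i : Fin 3) :
    T1.adjugate i = c ^ 2 • Matrix.vecMul (T0.adjugate i) P.adjugate := by
  subst h
  rw [Matrix.adjugate_smul, Matrix.adjugate_mul_distrib, Fintype.card_fin]
  ext j
  simp [Matrix.mul_apply, Matrix.vecMul, dotProduct]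

/-- A matrix with nonzero determinant has no zero row in its adjugate (3×3, domain). -/
theorem adjugate_row_ne_zero {R : Type*} [CommRing R] [IsDomain R] {T : Matrix (Fin 3) (Fin 3) R}
    (hT : T.det ≠ 0) (i : Fin 3) : T.adjugate i ≠ 0 := by
  intro h
  have h1 : (T.adjugate).det = 0 := Matrix.det_eq_zero_of_row_eq_zero i (fun j => congrFun h j)
  rw [Matrix.det_adjugate, Fintype.card_fin] at h1
  exact hT (by simpa using h1)

/-- **Reduction of clause (N) (window form) to a window determinant.**  Let `T n` (the real frames) satisfy
`det T n ≠ 0` and the scaled chain rule `T (n+1) = c n • (P n · T n)` with `c n ≠ 0` for `n ≥ n₀`, and let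
`f n = κ n · adj(T n)₀₂` with `κ n ≠ 0` (for the record ray: `T n = realFrame (bRecord n)`, `κ n = −ρ_n`,
`recordForm_eq_adjugate`).  If the window determinant of `(P n, P (n+1))` is eventually nonzero, then
`f n ≠ 0` for infinitely many `n` — indeed in every window `{n, n+1, n+2}` with `n` large. -/
theorem frequently_ne_zero_of_window (f : ℕ → ℝ) (T P : ℕ → Matrix (Fin 3) (Fin 3) ℝ) (c κ : ℕ → ℝ)
    (n₀ : ℕ) (hT : ∀ n ≥ n₀, (T n).det ≠ 0) (hc : ∀ n ≥ n₀, c n ≠ 0) (hκ : ∀ n ≥ n₀, κ n ≠ 0)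
    (hstep : ∀ n ≥ n₀, T (n + 1) = c n • (P n * T n))
    (hf : ∀ n ≥ n₀, f n = κ n * (T n).adjugate 0 2)
    (hD : ∀ᶠ n in Filter.atTop, (windowMat (P n) (P (n + 1))).det ≠ 0) :
    ∃ᶠ n in Filter.atTop, f n ≠ 0 := by
  rw [Filter.frequently_atTop]
  intro N
  obtain ⟨N₁, hN₁⟩ := Filter.eventually_atTop.1 hD
  obtain ⟨n, hnN, hn1, hn0⟩ : ∃ n, N ≤ n ∧ N₁ ≤ n ∧ n₀ ≤ n := ⟨N + N₁ + n₀, by omega, by omega, by omega⟩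
  have hw := window_of_transport (pow_ne_zero 2 (hc n hn0)) (pow_ne_zero 2 (hc (n + 1) (by omega)))
    (adjugate_row_of_step (hstep n hn0) 0) (adjugate_row_of_step (hstep (n + 1) (by omega)) 0)
    (adjugate_row_ne_zero (hT n hn0) 0) (hN₁ n hn1)
  rcases hw with h | h | h
  · exact ⟨n, hnN, by rw [hf n hn0]; exact mul_ne_zero (hκ n hn0) h⟩
  · exact ⟨n + 1, by omega, by rw [hf (n + 1) (by omega)]; exact mul_ne_zero (hκ (n + 1) (by omega)) h⟩
  · exact ⟨n + 2, by omega, by rw [hf (n + 2) (by omega)]; exact mul_ne_zero (hκ (n + 2) (by omega)) h⟩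

end Summit.KontsevichZagierPeriods.Zeta5Search.RecordRay.Connection

end
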